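import Summits.ValiantsHypothesis.ValiantsHypothesis.Theorems.RefutationDegreeMrCalibration

/-!
# Route `RefutationDegree`, crux `BeyondHessianNs` (stmt-ValiantsHypothesis-5641), line `Sketch` —
# JET CALIBRATION: a separating polynomial on coefficient space IS a Nullstellensatz refutation

Helper file (no definitions), supporting `RefutationDegree.BeyondHessianNs`.

Let `Rep(n,m)` be the coefficient system of the defect `P = det A(x) - per_n(x)` of the generic affine
pencil `A(x) = A₀ + Σ_e x_e A_e` of size `m` (unknowns `a`, `R = ℂ[a]`), as inlined in the route file.
**Calibration theorem** (`exists_refutation_of_separating`): let `y ∈ ℂ^{n × n}` be a zero of `per_n`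
and let `Ψ` be a polynomial in the coefficients `(g_μ)_μ` of a polynomial `g(x)` such that

* `Ψ(per_n) ≠ 0`, and
* for every field `K ⊇ ℂ` and every size-`m` matrix `A` of affine linear forms over `K` with
  `det A(y) = 0`, `Ψ` vanishes at the coefficients of `det A(x)` ("`Ψ` vanishes on the determinants of
  affine pencils singular at `y`", functorially in the field).

Then `Rep(n,m)` has a Nullstellensatz refutation `Σ_μ h_μ · coeff_μ P = 1` with every product of degree
`≤ m · deg Ψ` (Mignon–Ressayre's certificate `MrCalibration` is the instance `Ψ =` a `(2m+1)`-minor of the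
Hessian part of the jet, degree `2m+1`); the crux is thereby reduced to the existence, for all large `n`
and `m = ⌊n²/2⌋ + 1`, of such a `Ψ` of degree `n^{O(1)}` (registered stub `stub_polyJetEq`, line `Sketch`).

Proof.  `Φ := Ψ(coeff det A(x)) ∈ R` has degree `≤ m · deg Ψ` (the coefficients have degree `m`).
`det A(y) ∈ R` is prime (`prime_det_evalA`); over the field `K = Frac(R/(det A(y)))` the image of the
generic pencil is an affine pencil singular at `y`, so the hypothesis gives `Φ ↦ 0`, i.e.
`Φ = det A(y) · Q` with `deg Q ≤ m · deg Ψ - m`.  Modulo the equations with bookkept degrees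
(`LC[P, d, f]` of `…MrCalibrationLinComb`): `det A(y) ≡ per_n(y) = 0` at cost `0` (`lc_eval_defect`),
so `Φ ∈ LC_{m(deg Ψ - 1)}`; and `Φ - Ψ(per_n) ∈ LC_{m(deg Ψ - 1)}` by telescoping the monomials of `Ψ`
(`lc_aeval_sub_C_eval`).  Hence the non-zero constant `Ψ(per_n)` lies in `LC_{m(deg Ψ - 1)}` and
`1 = Ψ(per_n)⁻¹ · Ψ(per_n)`; products have degree `≤ m(deg Ψ - 1) + m = m · deg Ψ`.

References: Mignon–Ressayre, IMRN 2004 (order 2); Buss–Impagliazzo–Krajíček–Pudlák–Razborov–Sgall,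
Comput. Complexity 6 (1996/97) (NS degree); Landsberg, *Geometry and Complexity Theory* (2017), §6.4.5.
-/

noncomputable section

-- single-conjunct layout: Sub = Summit, duplicated namespace component intended
set_option linter.dupNamespace false

namespace Summit.ValiantsHypothesis.ValiantsHypothesis.Theorems.RefutationDegreeBeyondHessianNs

open MvPolynomial Matrix Literature.Computability.AlgebraicComplexity RefutationDegreeMrCalibration

/-! ## Degree-bounded combinations: evaluation of a polynomial `Ψ` -/

section LinComb

variable {K : Type*} [CommRing K] {σ τ : Type*} (P : MvPolynomial τ (MvPolynomial σ K))

/-- `LC[P, d, f]`: `f` is a combination `Σ_{μ ∈ supp P} h_μ · coeff_μ P` with `deg h_μ ≤ d`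
(local notation, as in `…MrCalibrationLinComb`). -/
local notation3 "LC[" P ", " d ", " f "]" =>
  ∃ h : (τ →₀ ℕ) → MvPolynomial σ K, (∀ μ, MvPolynomial.totalDegree (h μ) ≤ d) ∧
    (∑ μ ∈ MvPolynomial.support P, h μ * MvPolynomial.coeff μ P) = f

/-- Combinations of degree `≤ d` are combinations of degree `≤ d'` for `d ≤ d'`. [folklore] -/
theorem lc_mono {d d' : ℕ} {f : MvPolynomial σ K} (hf : LC[P, d, f]) (hdd' : d ≤ d') :
    LC[P, d', f] := by
  obtain ⟨h, hd, rfl⟩ := hf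
  exact ⟨h, fun μ => (hd μ).trans hdd', rfl⟩

/-- A single coefficient of `P` is a degree-`0` combination. [folklore] -/
theorem lc_coeff (μ : τ →₀ ℕ) : LC[P, 0, coeff μ P] := by
  classical
  refine ⟨fun ν => if ν = μ then 1 else 0, fun ν => ?_, ?_⟩
  · show (if ν = μ then (1 : MvPolynomial σ K) else 0).totalDegree ≤ 0
    split_ifs
    · exact totalDegree_one.le
    · exact totalDegree_zero.le
  · simp only [ite_mul, one_mul, zero_mul, Finset.sum_ite_eq']
    split_ifs with hμ
    · rfl
    · exact (notMem_support_iff.mp hμ).symm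

/-- Powers: if `a - C β` is a degree-`0` combination and `deg a ≤ d`, then `a^k - C β^k` is a
combination of degree `≤ d (k - 1)` (telescoping `a^{k+1} - β^{k+1} = a (a^k - β^k) + (a - β) β^k`).
[folklore] -/
theorem lc_pow_sub_C_pow {d : ℕ} (a : MvPolynomial σ K) (β : K) (ha : a.totalDegree ≤ d)
    (hab : LC[P, 0, a - C β]) (k : ℕ) : LC[P, d * (k - 1), a ^ k - C (β ^ k)] := by
  induction k with
  | zero =>
    rw [pow_zero, pow_zero, map_one, sub_self]
    exact lc_zero P _
  | succ k ih =>
    have hsplit : a ^ (k + 1) - C (β ^ (k + 1)) =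
        a * (a ^ k - C (β ^ k)) + C (β ^ k) * (a - C β) := by
      rw [map_pow, map_pow]; ring
    rw [hsplit]
    rcases k with _ | j
    · have h0 : a * (a ^ 0 - C (β ^ 0)) + C (β ^ 0) * (a - C β) = a - C β := by
        rw [pow_zero, pow_zero, map_one]; ring
      rw [h0]
      exact lc_mono P hab (Nat.zero_le _)
    · refine lc_add P ?_ ?_
      · refine lc_mul P a ha ih (le_of_eq ?_)
        simp only [Nat.add_sub_cancel]
        ring
      · exact lc_mul P (C (β ^ (j + 1))) ((totalDegree_C _).le) hab (Nat.zero_le _)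

/-- Monomials: if every `u t - C (β t)` is a degree-`0` combination and `deg (u t) ≤ d`, then
`Π_t (u t)^{ν t} - C (Π_t (β t)^{ν t})` is a combination of degree `≤ d (|ν| - 1)`. [folklore] -/
theorem lc_monomial_sub_C {ι : Type*} {d : ℕ} (u : ι → MvPolynomial σ K) (β : ι → K)
    (hu : ∀ t, (u t).totalDegree ≤ d) (huβ : ∀ t, LC[P, 0, u t - C (β t)]) (ν : ι →₀ ℕ) :
    LC[P, d * ((ν.sum fun _ e => e) - 1),
      (∏ t ∈ ν.support, u t ^ ν t) - C (∏ t ∈ ν.support, β t ^ ν t)] := by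
  classical
  suffices hs : ∀ s : Finset ι, LC[P, d * ((∑ t ∈ s, ν t) - 1),
      (∏ t ∈ s, u t ^ ν t) - C (∏ t ∈ s, β t ^ ν t)] by
    have h := hs ν.support
    rwa [show (∑ t ∈ ν.support, ν t) = ν.sum (fun _ e => e) from rfl] at h
  intro s
  induction s using Finset.induction_on with
  | empty =>
    rw [Finset.prod_empty, Finset.prod_empty, map_one, sub_self]
    exact lc_zero P _
  | insert i s hi ih =>
    rw [Finset.prod_insert hi, Finset.prod_insert hi, Finset.sum_insert hi]
    set S := ∑ t ∈ s, ν t with hS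
    have hsplit : u i ^ ν i * ∏ t ∈ s, u t ^ ν t - C (β i ^ ν i * ∏ t ∈ s, β t ^ ν t) =
        u i ^ ν i * ((∏ t ∈ s, u t ^ ν t) - C (∏ t ∈ s, β t ^ ν t)) +
          C (∏ t ∈ s, β t ^ ν t) * (u i ^ ν i - C (β i ^ ν i)) := by
      rw [map_mul]; ring
    rw [hsplit]
    refine lc_add P ?_ ?_
    · rcases Nat.eq_zero_or_pos S with h0 | hpos
      · have hs0 : ∀ t ∈ s, ν t = 0 := fun t ht => Finset.sum_eq_zero_iff.mp (hS ▸ h0) t ht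
        have h1 : (∏ t ∈ s, u t ^ ν t) = 1 :=
          Finset.prod_eq_one fun t ht => by rw [hs0 t ht, pow_zero]
        have h2 : (∏ t ∈ s, β t ^ ν t) = 1 :=
          Finset.prod_eq_one fun t ht => by rw [hs0 t ht, pow_zero]
        rw [h1, h2, map_one, sub_self, mul_zero]
        exact lc_zero P _
      · have hdeg : (u i ^ ν i).totalDegree ≤ d * ν i :=
          (totalDegree_pow _ _).trans (by rw [mul_comm]; exact Nat.mul_le_mul_right _ (hu i))
        refine lc_mul P _ hdeg ih (le_of_eq ?_)
        rw [← Nat.mul_add]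
        congr 1
        omega
    · refine lc_mul P _ ((totalDegree_C _).le)
        (lc_pow_sub_C_pow P (u i) (β i) (hu i) (huβ i) (ν i)) ?_
      rw [Nat.zero_add]
      exact Nat.mul_le_mul_left _ (by omega)

/-- **Evaluation.** If every `u t - C (β t)` is a degree-`0` combination, `deg (u t) ≤ d` and
`deg Ψ ≤ D`, then `Ψ(u) - C (Ψ(β))` is a combination of degree `≤ d (D - 1)`. [folklore] -/
theorem lc_aeval_sub_C_eval {ι : Type*} {d D : ℕ} (Ψ : MvPolynomial ι K) (hΨ : Ψ.totalDegree ≤ D)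
    (u : ι → MvPolynomial σ K) (β : ι → K)
    (hu : ∀ t, (u t).totalDegree ≤ d) (huβ : ∀ t, LC[P, 0, u t - C (β t)]) :
    LC[P, d * (D - 1), aeval u Ψ - C (eval β Ψ)] := by
  classical
  have hu' : aeval u Ψ = ∑ ν ∈ Ψ.support, C (coeff ν Ψ) * ∏ t ∈ ν.support, u t ^ ν t := by
    rw [MvPolynomial.aeval_def, eval₂_eq]
    rfl
  have hβ' : (C (eval β Ψ) : MvPolynomial σ K) = ∑ ν ∈ Ψ.support,
      C (coeff ν Ψ) * C (∏ t ∈ ν.support, β t ^ ν t) := by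
    rw [eval_eq, map_sum]
    refine Finset.sum_congr rfl fun ν _ => ?_
    rw [map_mul]
  rw [hu', hβ', ← Finset.sum_sub_distrib]
  refine lc_sum P _ _ fun ν hν => ?_
  rw [← mul_sub]
  refine lc_mul P _ ((totalDegree_C _).le) (lc_monomial_sub_C P u β hu huβ ν) ?_
  rw [Nat.zero_add]
  exact Nat.mul_le_mul_left _ (Nat.sub_le_sub_right ((le_totalDegree hν).trans hΨ) 1)

end LinComb

/-! ## The calibration theorem -/

section Main

variable {n m : ℕ}

/-- The generic pencil `A(x) = A₀ + Σ_e x_e A_e` with unknown entries (local notation; the item's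
statement inlines it). -/
local notation3 (prettyPrint := false) "genA[" n ", " m "]" => (Matrix.of fun i j : Fin m =>
    MvPolynomial.C (MvPolynomial.X (none, (i, j))) +
      ∑ e : Fin n × Fin n, MvPolynomial.X e * MvPolynomial.C (MvPolynomial.X (some e, (i, j))) :
  Matrix (Fin m) (Fin m) (MvPolynomial (Fin n × Fin n)
    (MvPolynomial (Option (Fin n × Fin n) × (Fin m × Fin m)) ℂ)))

/-- The value `B = A(y)` of the pencil at a point `y` (local notation). -/
local notation3 (prettyPrint := false) "evalA[" n ", " m ", " y "]" => (Matrix.of fun i j : Fin m =>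
    MvPolynomial.X (none, (i, j)) +
      ∑ e : Fin n × Fin n, MvPolynomial.C (y e) * MvPolynomial.X (some e, (i, j)) :
  Matrix (Fin m) (Fin m) (MvPolynomial (Option (Fin n × Fin n) × (Fin m × Fin m)) ℂ))

/-- The point `y` with coordinates read in the coefficient ring `R = ℂ[a]` (local notation). -/
local notation3 (prettyPrint := false) "Cpt[" n ", " m ", " y "]" => (fun e : Fin n × Fin n =>
  (MvPolynomial.C (y e) : MvPolynomial (Option (Fin n × Fin n) × (Fin m × Fin m)) ℂ))

/-- The defect `P = det A(x) - per_n(x) ∈ R[x]` of the system `Rep(n,m)` (local notation; the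
item's statement inlines it). -/
local notation3 (prettyPrint := false) "defect[" n ", " m "]" =>
  ((genA[n, m]).det - MvPolynomial.map MvPolynomial.C
    (Literature.Computability.AlgebraicComplexity.perPoly (Fin n) ℂ))

/-- `LC[P, d, f]`: `f = Σ_{μ ∈ supp P} h_μ · coeff_μ P` with `deg h_μ ≤ d` (local notation, as in
the file `…MrCalibrationLinComb`). -/
local notation3 (prettyPrint := false) "LC[" P ", " d ", " f "]" =>
  ∃ h : (Fin _ × Fin _ →₀ ℕ) → MvPolynomial (Option (Fin _ × Fin _) × (Fin _ × Fin _)) ℂ,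
    (∀ μ, MvPolynomial.totalDegree (h μ) ≤ d) ∧
    (∑ μ ∈ MvPolynomial.support P, h μ * MvPolynomial.coeff μ P) = f

/-- Degree of an evaluation: if `deg (u t) ≤ d` for all `t` and `deg Ψ ≤ D`, then
`deg Ψ(u) ≤ d · D`. [folklore] -/
theorem totalDegree_aeval_le_mul {K : Type*} [CommRing K] {σ ι : Type*} (Ψ : MvPolynomial ι K)
    {d D : ℕ} (hΨ : Ψ.totalDegree ≤ D) (u : ι → MvPolynomial σ K)
    (hu : ∀ t, (u t).totalDegree ≤ d) : (aeval u Ψ).totalDegree ≤ d * D := by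
  rw [MvPolynomial.aeval_def, eval₂_eq]
  refine totalDegree_finsetSum_le fun ν hν => ?_
  refine (totalDegree_mul _ _).trans ?_
  rw [show (algebraMap K (MvPolynomial σ K)) (coeff ν Ψ) = C (coeff ν Ψ) from rfl, totalDegree_C,
    zero_add]
  refine (totalDegree_finsetProd _ _).trans ?_
  calc ∑ t ∈ ν.support, (u t ^ ν t).totalDegree
      ≤ ∑ t ∈ ν.support, d * ν t := Finset.sum_le_sum fun t _ =>
          (totalDegree_pow _ _).trans (by rw [mul_comm]; exact Nat.mul_le_mul_right _ (hu t))
    _ = d * ∑ t ∈ ν.support, ν t := (Finset.mul_sum _ _ _).symm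
    _ ≤ d * D := Nat.mul_le_mul_left _ ((le_totalDegree hν).trans hΨ)

/-- **Jet calibration** (line `Sketch` of crux `BeyondHessianNs`; the order-2 instance is
Mignon–Ressayre's certificate `MrCalibration`).  Let `y` be a zero of `per_n`, `m ≥ 1`, and let `Ψ` be
a polynomial in the coefficients of a degree-`≤ m` polynomial in `x` with `deg Ψ ≤ D`, `Ψ(per_n) ≠ 0`,
which vanishes — over every field `K` receiving `ℂ` — at the coefficients of `det A(x)` for every
`m × m` matrix `A` of affine linear forms over `K` with `det A(y) = 0`.  Then the coefficient system
`Rep(n,m)` of `P = det A(x) - per_n(x)` (generic pencil) has a Nullstellensatz refutation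
`Σ_μ h_μ · coeff_μ P = 1` with all products of degree `≤ m · D`. -/
theorem exists_refutation_of_separating (hm : 0 < m) (y : Fin n × Fin n → ℂ)
    (hy : eval y (perPoly (Fin n) ℂ) = 0) {D : ℕ}
    (Ψ : MvPolynomial ((Fin n × Fin n) →₀ ℕ) ℂ) (hΨD : Ψ.totalDegree ≤ D)
    (hΨper : eval (fun μ => coeff μ (perPoly (Fin n) ℂ)) Ψ ≠ 0)
    (hΨvan : ∀ (K : Type) [Field K] (φ : ℂ →+* K)
      (A : Matrix (Fin m) (Fin m) (MvPolynomial (Fin n × Fin n) K)),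
      (∀ i j, (A i j).totalDegree ≤ 1) → eval (fun e => φ (y e)) A.det = 0 →
        eval₂ φ (fun μ => coeff μ A.det) Ψ = 0) :
    ∃ hh : (Fin n × Fin n →₀ ℕ) → MvPolynomial (Option (Fin n × Fin n) × (Fin m × Fin m)) ℂ,
      (∀ μ, (hh μ * (defect[n, m]).coeff μ).totalDegree ≤ m * D) ∧
        ∑ μ ∈ (defect[n, m]).support, hh μ * (defect[n, m]).coeff μ = 1 := by
  classical
  haveI : Nonempty (Fin m) := ⟨⟨0, hm⟩⟩
  -- the constant `κ = Ψ(per_n) ≠ 0`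
  set κ : ℂ := eval (fun μ => coeff μ (perPoly (Fin n) ℂ)) Ψ with hκ
  -- `D = 0` is absurd: `Ψ` is the constant `κ`, and the zero pencil is singular at `y`
  rcases Nat.eq_zero_or_pos D with rfl | hD
  · exfalso
    have hΨC : Ψ = C (coeff 0 Ψ) :=
      (totalDegree_eq_zero_iff_eq_C (p := Ψ)).mp (Nat.le_zero.mp hΨD)
    have h0 := hΨvan ℂ (RingHom.id ℂ) 0 (fun i j => by
      rw [Matrix.zero_apply, totalDegree_zero]; exact Nat.zero_le _) (by
      rw [Matrix.det_zero, map_zero])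
    rw [hΨC, eval₂_C, RingHom.id_apply] at h0
    apply hΨper
    rw [hκ, hΨC, eval_C, h0]
  obtain ⟨D, rfl⟩ : ∃ j, D = j + 1 := ⟨D - 1, (Nat.sub_add_cancel hD).symm⟩
  -- notation
  set B := evalA[n, m, y] with hB
  set A := genA[n, m] with hA
  set c : (Fin n × Fin n →₀ ℕ) → MvPolynomial (Option (Fin n × Fin n) × (Fin m × Fin m)) ℂ :=
    fun μ => coeff μ A.det with hc
  set Φ := aeval c Ψ with hΦ
  -- Piece A: `Φ - C κ ∈ LC_{m (D - 1)}`
  have hcdeg : ∀ μ, (c μ).totalDegree ≤ m := fun μ => coeffDeg_det_genA μ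
  have hcoeff : ∀ μ, c μ - C (coeff μ (perPoly (Fin n) ℂ)) = coeff μ defect[n, m] := fun μ => by
    rw [coeff_sub, coeff_map]
  have hPieceA : LC[defect[n, m], m * (D + 1 - 1), Φ - C κ] := by
    refine lc_aeval_sub_C_eval _ Ψ hΨD c _ hcdeg fun μ => ?_
    rw [hcoeff]
    exact lc_coeff _ μ
  -- Piece B: `Φ = det B · Q`
  have hprime : Prime B.det := prime_det_evalA hm y
  let 𝔮 : Ideal (MvPolynomial (Option (Fin n × Fin n) × (Fin m × Fin m)) ℂ) := Ideal.span {B.det}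
  haveI h𝔮 : 𝔮.IsPrime := (Ideal.span_singleton_prime hprime.ne_zero).mpr hprime
  let φ : MvPolynomial (Option (Fin n × Fin n) × (Fin m × Fin m)) ℂ →+*
      FractionRing (MvPolynomial (Option (Fin n × Fin n) × (Fin m × Fin m)) ℂ ⧸ 𝔮) :=
    (algebraMap _ _).comp (Ideal.Quotient.mk 𝔮)
  have hφ0 : φ B.det = 0 := by
    have : Ideal.Quotient.mk 𝔮 B.det = 0 :=
      Ideal.Quotient.eq_zero_iff_mem.mpr (Ideal.mem_span_singleton_self _)
    simp [φ, this]
  have hφker : ∀ f, φ f = 0 → B.det ∣ f := fun f hf => by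
    have h1 : Ideal.Quotient.mk 𝔮 f = 0 := by
      apply IsFractionRing.injective (MvPolynomial (Option (Fin n × Fin n) × (Fin m × Fin m)) ℂ ⧸ 𝔮)
        (FractionRing (MvPolynomial (Option (Fin n × Fin n) × (Fin m × Fin m)) ℂ ⧸ 𝔮))
      rw [map_zero]
      exact hf
    exact Ideal.mem_span_singleton.mp (Ideal.Quotient.eq_zero_iff_mem.mp h1)
  -- the generic pencil over the field `K = Frac(R/(det B))`, singular at `y`
  set AK := A.map (MvPolynomial.map φ) with hAK
  have hdegK : ∀ i j, (AK i j).totalDegree ≤ 1 := by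
    intro i j
    rw [hAK, Matrix.map_apply, hA, Matrix.of_apply, map_add, map_C, map_sum]
    refine (totalDegree_add _ _).trans (max_le ((totalDegree_C _).trans_le (Nat.zero_le _)) ?_)
    refine totalDegree_finsetSum_le fun e _ => ?_
    rw [map_mul, map_X, map_C]
    refine (totalDegree_mul _ _).trans ?_
    rw [totalDegree_C, add_zero]
    exact (totalDegree_X _).le
  have hdetK : AK.det = MvPolynomial.map φ A.det := by
    rw [hAK, ← RingHom.mapMatrix_apply, ← RingHom.map_det]
  have h0K : eval (fun e => (φ.comp C) (y e)) AK.det = 0 := by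
    rw [hdetK, eval_map]
    have h := eval₂_comp_left φ (RingHom.id _) Cpt[n, m, y] A.det
    rw [RingHom.comp_id] at h
    have h' : eval₂ φ (fun e => (φ.comp C) (y e)) A.det = φ (eval Cpt[n, m, y] A.det) := by
      rw [show eval Cpt[n, m, y] A.det = eval₂ (RingHom.id _) Cpt[n, m, y] A.det from rfl, h]
      rfl
    rw [h', hA, eval_genA_det, ← hB, hφ0]
  have hΦK : φ Φ = 0 := by
    have h := hΨvan _ (φ.comp C) AK hdegK h0K
    have hcK : (fun μ => coeff μ AK.det) = φ ∘ c := by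
      funext μ
      rw [hdetK, coeff_map]
      rfl
    rw [hcK] at h
    rw [hΦ, MvPolynomial.aeval_def, eval₂_comp_left φ]
    exact h
  obtain ⟨Q, hQ⟩ := hφker Φ hΦK
  -- the degree of `Q`
  have hQdeg : Q.totalDegree ≤ m * (D + 1 - 1) := by
    by_cases hQ0 : Q = 0
    · rw [hQ0, totalDegree_zero]; exact Nat.zero_le _
    have hΦdeg : Φ.totalDegree ≤ m * (D + 1) := totalDegree_aeval_le_mul Ψ hΨD c hcdeg
    rw [hQ, totalDegree_mul_of_isDomain hprime.ne_zero hQ0, hB, totalDegree_det_evalA,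
      Nat.mul_succ] at hΦdeg
    rw [Nat.add_sub_cancel]
    omega
  -- `det B ≡ per_n(y) = 0` at cost `0`
  have hBlc : LC[defect[n, m], 0, B.det] := by
    have h := lc_eval_defect (n := n) (m := m) y
    rw [eval_defect, hy, map_zero, sub_zero] at h
    exact h
  have hΦlc : LC[defect[n, m], m * (D + 1 - 1), Φ] := by
    have h := lc_mul (d' := m * (D + 1 - 1)) _ Q hQdeg hBlc (Nat.add_zero _).le
    have hQ' : Φ = Q * B.det := by rw [hQ, mul_comm]
    rw [hQ']
    exact h
  -- conclusion: `C κ ∈ LC_{m(D-1)}`, `1 = κ⁻¹ κ`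
  have hκlc : LC[defect[n, m], m * (D + 1 - 1), C κ] := by
    have h := lc_sub _ hΦlc hPieceA
    rwa [sub_sub_cancel] at h
  have hone : LC[defect[n, m], m * (D + 1 - 1),
      (1 : MvPolynomial (Option (Fin n × Fin n) × (Fin m × Fin m)) ℂ)] := by
    have h := lc_mul (d' := m * (D + 1 - 1)) _ (C κ⁻¹) (totalDegree_C _).le hκlc (Nat.zero_add _).le
    rw [← map_mul, inv_mul_cancel₀ hΨper, map_one] at h
    exact h
  obtain ⟨hh, hdeg, hsum⟩ := hone
  refine ⟨hh, fun μ => ?_, hsum⟩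
  calc (hh μ * coeff μ defect[n, m]).totalDegree
      ≤ (hh μ).totalDegree + (coeff μ defect[n, m]).totalDegree := totalDegree_mul _ _
    _ ≤ m * (D + 1 - 1) + m := add_le_add (hdeg μ) (coeffDeg_defect μ)
    _ = m * (D + 1) := by rw [Nat.add_sub_cancel, Nat.mul_succ]

/-- **The registered stub `stub_jetCalibration`** of line `Sketch` (skeleton
`Cruxes/BeyondHessianNs/Lines/Sketch.lean`, v6): the calibration theorem as registered on the crux item. -/
theorem stub_jetCalibration : ∀ (n m : ℕ), 0 < m → ∀ (y : Fin n × Fin n → ℂ),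
    MvPolynomial.eval y (Literature.Computability.AlgebraicComplexity.perPoly (Fin n) ℂ) = 0 →
    ∀ (D : ℕ) (Ψ : MvPolynomial (Fin n × Fin n →₀ ℕ) ℂ), Ψ.totalDegree ≤ D →
    MvPolynomial.eval (fun μ => MvPolynomial.coeff μ
      (Literature.Computability.AlgebraicComplexity.perPoly (Fin n) ℂ)) Ψ ≠ 0 →
    (∀ (K : Type) [Field K] (φ : ℂ →+* K)
      (A : Matrix (Fin m) (Fin m) (MvPolynomial (Fin n × Fin n) K)),
      (∀ i j, (A i j).totalDegree ≤ 1) → MvPolynomial.eval (fun e => φ (y e)) A.det = 0 →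
        MvPolynomial.eval₂ φ (fun μ => MvPolynomial.coeff μ A.det) Ψ = 0) →
    ∃ hh : (Fin n × Fin n →₀ ℕ) → MvPolynomial (Option (Fin n × Fin n) × (Fin m × Fin m)) ℂ,
      (∀ μ, (hh μ * MvPolynomial.coeff μ ((Matrix.of fun i j : Fin m =>
          MvPolynomial.C (MvPolynomial.X (none, (i, j))) +
            ∑ e : Fin n × Fin n, MvPolynomial.X e * MvPolynomial.C (MvPolynomial.X (some e, (i, j))) :
          Matrix (Fin m) (Fin m) (MvPolynomial (Fin n × Fin n)
            (MvPolynomial (Option (Fin n × Fin n) × (Fin m × Fin m)) ℂ))).det -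
          MvPolynomial.map MvPolynomial.C
            (Literature.Computability.AlgebraicComplexity.perPoly (Fin n) ℂ))).totalDegree ≤ m * D) ∧
      ∑ μ ∈ ((Matrix.of fun i j : Fin m =>
          MvPolynomial.C (MvPolynomial.X (none, (i, j))) +
            ∑ e : Fin n × Fin n, MvPolynomial.X e * MvPolynomial.C (MvPolynomial.X (some e, (i, j))) :
          Matrix (Fin m) (Fin m) (MvPolynomial (Fin n × Fin n)
            (MvPolynomial (Option (Fin n × Fin n) × (Fin m × Fin m)) ℂ))).det -
          MvPolynomial.map MvPolynomial.C
            (Literature.Computability.AlgebraicComplexity.perPoly (Fin n) ℂ)).support,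
        hh μ * MvPolynomial.coeff μ ((Matrix.of fun i j : Fin m =>
          MvPolynomial.C (MvPolynomial.X (none, (i, j))) +
            ∑ e : Fin n × Fin n, MvPolynomial.X e * MvPolynomial.C (MvPolynomial.X (some e, (i, j))) :
          Matrix (Fin m) (Fin m) (MvPolynomial (Fin n × Fin n)
            (MvPolynomial (Option (Fin n × Fin n) × (Fin m × Fin m)) ℂ))).det -
          MvPolynomial.map MvPolynomial.C
            (Literature.Computability.AlgebraicComplexity.perPoly (Fin n) ℂ)) = 1 :=
  fun _ _ hm y hy _ Ψ hΨD hΨper hΨvan => exists_refutation_of_separating hm y hy Ψ hΨD hΨper hΨvan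

end Main

end Summit.ValiantsHypothesis.ValiantsHypothesis.Theorems.RefutationDegreeBeyondHessianNs

end
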